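import Literature.NumberTheory.FaltingsSerre.GSp4F2AbsIrreducible
import HarnessLib

/-!
# The Faltings–Serre method after Brumer–Pacetti–Poor–Tornaría–Voight–Yuen, IX:
# subgroups of `S₆ ≅ Sp₄(𝔽₂)` containing a `5`-cycle — the two finite group-theory facts of the
# residual-image step, kernel-checked

[BPPTVY] = A. Brumer, A. Pacetti, C. Poor, G. Tornaría, J. Voight, D. S. Yuen, *On the paramodularity of
typical abelian surfaces*, Algebra & Number Theory **13**:5 (2019) 1145–1195 [cite: BrumerEtAl2019]
(PRINTED numbering).  The residual step of the certificates for `N = 349, 461, …` (cell pub-paramod,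
`certs/<N>/residual/residual.json`, "Route T") determines the image `G = im ρ̄_{f,2} ≤ GSp₄(𝔽₂) = S₆`
(identification `ι` of [BPPTVY, (5.1.1) p. 1173]; `GSp4F2.iotaMulEquiv`) from: (P1) an element of
order `5` in `G` (a good prime `p` with `Q_p(f,x) ≡ Φ₅ mod 2`); the transvection/transposition supplied
by inertia at `N` [BPPTVY, Lemma 4.3.10 p. 1172, proof of Prop. 5.2.4 p. 1175]; and TWO FINITE
STATEMENTS ABOUT `S₆`, recorded there as "finite statement about subgroups of S6; not machine-checked
here (could be decided in GAP/Lean); cited":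

* **(GT1)** a subgroup `G ≤ S₆` of order divisible by `5` has a core-free subgroup of index `5` or
  `6` — equivalently, a faithful transitive action on `5` or `6` of the six letters (so the fixed
  field of `G` is the Galois closure of a quintic or sextic field): `GSp4F2.exists_faithful_transitive_block_of_five_dvd_card`;
* **(GT2)** (Jordan) a subgroup `G ≤ S₆` containing a transposition and an element of order `5` is a
  point stabilizer `S₅(b) = Stab(x)` or all of `S₆`:
  `GSp4F2.eq_stabilizer_or_top_of_isSwap_mem_of_five_dvd_card`.

THIS FILE proves both in the kernel (standard axioms).  Ingredients: `decide +kernel` facts about the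
`720` elements of `S₆` (an element of order `5` has a unique fixed point and is transitive on the other
five letters; it is conjugate to `(1 2 3 4 5)`; for every transposition `τ`, `(1 2)` is a word in
`τ, (1 2 3 4 5)` — table `swapWords`; `Stab(6) = ⟨(1 2 3 4 5), (1 2)⟩` — word table `stabWords`, all
`120` elements), the maximality of `Stab(6)` in `S₆` (`eq_top_of_stabilizer_le`: a `6`-cycle is
`s₁ g s₂` with `s₁, s₂ ∈ Stab(6)` for any `g` moving `6`, then Mathlib's
`Equiv.Perm.closure_cycle_adjacent_swap`), Cauchy's theorem (Mathlib `exists_prime_orderOf_dvd_card'`)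
and conjugation transport (`MulAction.stabilizer_smul_eq_stabilizer_map_conj`).  Section E adds
the KERNEL CHECK `GSp4F2.isTransvection_iota_iff` (through the two-lookup entry formula `iotaE`): `ι(σ)` is a transvection (`≠ 1`, `(g-1)² = 0`,
`rk(g-1) = 1`) iff `σ` is a transposition — so [BPPTVY, Example 5.1.9 p. 1174] ("`ι(S₅(b))` has
transvections while `ι(S₅(a))` does not") identifies the point stabilizers with the printed `S₅(b)`, and
(GT2) is also stated with a transvection hypothesis
(`GSp4F2.eq_stabilizer_or_top_of_transvection_mem_of_five_dvd_card`).  Section F: a transitive proper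
subgroup of order divisible by `5` (e.g. `S₅(a)`) contains no transposition / transvection
(`GSp4F2.not_isSwap_of_mem_transitive`) — the second half of Example 5.1.9, as used in the proof of
[BPPTVY, Lemma 5.2.1 p. 1174].

## References
* [BPPTVY] ANT 13:5 (2019): (5.1.1) p. 1173, Example 5.1.9 p. 1174, Lemma 4.3.10 p. 1172,
  Prop. 5.2.4 p. 1175, Lemma 7.1.4 p. 1187. [cite: BrumerEtAl2019]
* C. Jordan, *Traité des substitutions* (1870), §§ on primitive groups containing a transposition —
  here replaced by a finite verification in `S₆`. [folklore]
-/

namespace Literature.NumberTheory.FaltingsSerre.GSp4F2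

open Equiv Equiv.Perm

/-! ### A. Kernel facts about `S₆` -/

/-- Generators `(1 2 3 4 5)`, `(1 2)` of `S₅(b) = Stab(6)`. [cite: BrumerEtAl2019, Example 5.1.9 p. 1174] -/
def gensST : Fin 2 → Perm (Fin 6) := ![c12345, t12]

/-- The `120` elements of `Stab(6)` as words in `(1 2 3 4 5)` (letter `0`) and `(1 2)` (letter `1`). [folklore] -/
def stabWords : List (List (Fin 2)) :=
  [[], [0], [1], [0, 0], [0, 1], [1, 0], [0, 0, 0], [0, 0, 1],
   [0, 1, 0], [1, 0, 0], [1, 0, 1], [0, 0, 0, 0], [0, 0, 0, 1], [0, 0, 1, 0], [0, 1, 0, 0], [0, 1, 0, 1],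
   [1, 0, 0, 0], [1, 0, 0, 1], [1, 0, 1, 0], [0, 0, 0, 0, 1], [0, 0, 0, 1, 0], [0, 0, 1, 0, 0], [0, 0, 1, 0, 1], [0, 1, 0, 0, 0],
   [0, 1, 0, 0, 1], [0, 1, 0, 1, 0], [1, 0, 0, 0, 0], [1, 0, 0, 0, 1], [1, 0, 0, 1, 0], [1, 0, 1, 0, 0], [1, 0, 1, 0, 1], [0, 0, 0, 0, 1, 0],
   [0, 0, 0, 1, 0, 0], [0, 0, 0, 1, 0, 1], [0, 0, 1, 0, 0, 0], [0, 0, 1, 0, 0, 1], [0, 0, 1, 0, 1, 0], [0, 1, 0, 0, 0, 0], [0, 1, 0, 0, 0, 1], [0, 1, 0, 0, 1, 0],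
   [0, 1, 0, 1, 0, 0], [1, 0, 0, 0, 1, 0], [1, 0, 0, 1, 0, 0], [1, 0, 0, 1, 0, 1], [1, 0, 1, 0, 0, 0], [1, 0, 1, 0, 0, 1], [0, 0, 0, 0, 1, 0, 0], [0, 0, 0, 0, 1, 0, 1],
   [0, 0, 0, 1, 0, 0, 0], [0, 0, 0, 1, 0, 0, 1], [0, 0, 0, 1, 0, 1, 0], [0, 0, 1, 0, 0, 0, 0], [0, 0, 1, 0, 0, 0, 1], [0, 0, 1, 0, 0, 1, 0], [0, 0, 1, 0, 1, 0, 0], [0, 1, 0, 0, 0, 1, 0],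
   [0, 1, 0, 0, 1, 0, 0], [0, 1, 0, 0, 1, 0, 1], [0, 1, 0, 1, 0, 0, 0], [0, 1, 0, 1, 0, 0, 1], [1, 0, 0, 0, 1, 0, 1], [1, 0, 0, 1, 0, 0, 1], [1, 0, 0, 1, 0, 1, 0], [1, 0, 1, 0, 0, 0, 0],
   [1, 0, 1, 0, 0, 0, 1], [1, 0, 1, 0, 0, 1, 0], [0, 0, 0, 0, 1, 0, 0, 0], [0, 0, 0, 0, 1, 0, 0, 1], [0, 0, 0, 0, 1, 0, 1, 0], [0, 0, 0, 1, 0, 0, 0, 0], [0, 0, 0, 1, 0, 0, 0, 1], [0, 0, 0, 1, 0, 0, 1, 0],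
   [0, 0, 0, 1, 0, 1, 0, 0], [0, 0, 1, 0, 0, 0, 1, 0], [0, 0, 1, 0, 0, 1, 0, 0], [0, 0, 1, 0, 0, 1, 0, 1], [0, 0, 1, 0, 1, 0, 0, 0], [0, 0, 1, 0, 1, 0, 0, 1], [0, 1, 0, 0, 0, 1, 0, 1], [0, 1, 0, 0, 1, 0, 0, 1],
   [0, 1, 0, 0, 1, 0, 1, 0], [0, 1, 0, 1, 0, 0, 0, 0], [0, 1, 0, 1, 0, 0, 0, 1], [0, 1, 0, 1, 0, 0, 1, 0], [1, 0, 0, 0, 1, 0, 1, 0], [1, 0, 0, 1, 0, 0, 1, 0], [1, 0, 1, 0, 0, 0, 1, 0], [1, 0, 1, 0, 0, 1, 0, 0],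
   [0, 0, 0, 0, 1, 0, 0, 0, 1], [0, 0, 0, 0, 1, 0, 0, 1, 0], [0, 0, 0, 0, 1, 0, 1, 0, 0], [0, 0, 0, 1, 0, 0, 0, 1, 0], [0, 0, 0, 1, 0, 0, 1, 0, 0], [0, 0, 0, 1, 0, 0, 1, 0, 1], [0, 0, 0, 1, 0, 1, 0, 0, 0], [0, 0, 0, 1, 0, 1, 0, 0, 1],
   [0, 0, 1, 0, 0, 1, 0, 1, 0], [0, 0, 1, 0, 1, 0, 0, 0, 0], [0, 0, 1, 0, 1, 0, 0, 0, 1], [0, 0, 1, 0, 1, 0, 0, 1, 0], [0, 1, 0, 0, 0, 1, 0, 1, 0], [0, 1, 0, 0, 1, 0, 0, 1, 0], [0, 1, 0, 1, 0, 0, 0, 1, 0], [0, 1, 0, 1, 0, 0, 1, 0, 0],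
   [1, 0, 0, 0, 1, 0, 1, 0, 0], [1, 0, 0, 1, 0, 0, 1, 0, 1], [1, 0, 1, 0, 0, 1, 0, 0, 1], [0, 0, 0, 0, 1, 0, 0, 0, 1, 0], [0, 0, 0, 0, 1, 0, 0, 1, 0, 0], [0, 0, 0, 0, 1, 0, 0, 1, 0, 1], [0, 0, 0, 0, 1, 0, 1, 0, 0, 0], [0, 0, 0, 0, 1, 0, 1, 0, 0, 1],
   [0, 0, 0, 1, 0, 0, 1, 0, 1, 0], [0, 0, 0, 1, 0, 1, 0, 0, 0, 0], [0, 0, 1, 0, 1, 0, 0, 1, 0, 0], [0, 1, 0, 0, 1, 0, 0, 1, 0, 1], [0, 1, 0, 1, 0, 0, 1, 0, 0, 1], [1, 0, 0, 1, 0, 0, 1, 0, 1, 0], [0, 0, 0, 0, 1, 0, 0, 1, 0, 1, 0], [0, 0, 0, 0, 1, 0, 1, 0, 0, 0, 0]]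

/-- KERNEL CHECK: every `σ ∈ S₆` fixing `6` is one of the `120` words of `stabWords`. [folklore] -/
theorem stabWords_complete :
    ∀ σ : Perm (Fin 6), σ 5 = 5 → σ ∈ stabWords.map (evalWord gensST) := by
  unfold stabWords gensST evalWord c12345 t12
  decide +kernel

/-- **`S₅(b) = Stab(6) = ⟨(1 2 3 4 5), (1 2)⟩`** as subgroups of `S₆`. [cite: BrumerEtAl2019, Example 5.1.9 p. 1174] -/
theorem stabilizer_eq_closure :
    MulAction.stabilizer (Perm (Fin 6)) (5 : Fin 6) = Subgroup.closure (Set.range gensST) := by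
  apply le_antisymm
  · intro σ hσ
    rw [MulAction.mem_stabilizer_iff, Perm.smul_def] at hσ
    have hmem := stabWords_complete σ hσ
    rw [List.mem_map] at hmem
    obtain ⟨w, -, hw⟩ := hmem
    rw [← hw]
    exact evalWord_mem gensST w
  · rw [Subgroup.closure_le]
    rintro _ ⟨i, rfl⟩
    rw [SetLike.mem_coe, MulAction.mem_stabilizer_iff, Perm.smul_def]
    unfold gensST c12345 t12
    fin_cases i <;> decide

/-- For each transposition `τ` of `S₆`, a word in `τ` (letter `0`) and `(1 2 3 4 5)` (letter `1`)
equal to `(1 2)` (one of these fifteen works). [folklore] -/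
def swapWords : List (List (Fin 2)) :=
  [[0], [0, 1, 0, 1, 0, 1], [0, 1, 1, 1, 0, 1, 1, 0], [1, 0, 1, 1, 1, 1], [0, 1, 0, 1, 1, 1, 1, 0],
   [1, 1, 1, 1, 0, 1], [0, 1, 1, 0, 1, 1, 1, 0], [1, 0, 1, 0, 1, 0], [0, 1, 1, 1, 1, 0, 1, 0],
   [1, 1, 1, 0, 1, 1], [1, 0, 1, 0, 1, 1, 1, 0, 1, 1], [0, 1, 0, 1, 0, 1, 0, 1, 1, 0, 1],
   [1, 1, 0, 1, 1, 1], [0, 1, 0, 1, 0, 1, 1, 0, 1, 0, 1], [0, 1, 0, 1, 1, 0, 1, 0, 1, 0, 1]]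

/-- KERNEL CHECK: for every transposition `(a b)`, `(1 2) ∈ ⟨(a b), (1 2 3 4 5)⟩`, witnessed by a
word of `swapWords`. [folklore] -/
theorem t12_word_of_swap :
    ∀ a b : Fin 6, a ≠ b → ∃ w ∈ swapWords, evalWord ![swap a b, c12345] w = t12 := by
  unfold swapWords evalWord c12345 t12
  decide +kernel

/-- `(1 2) ∈ ⟨(a b), (1 2 3 4 5)⟩` for every transposition `(a b)`. [folklore] -/
theorem t12_mem_closure_swap {a b : Fin 6} (hab : a ≠ b) :
    t12 ∈ Subgroup.closure (Set.range ![swap a b, c12345]) := by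
  obtain ⟨w, -, hw⟩ := t12_word_of_swap a b hab
  rw [← hw]
  exact evalWord_mem _ w

/-- KERNEL CHECK: an element of order `5` of `S₆` is conjugate to `(1 2 3 4 5)`. [folklore] -/
theorem exists_conj_c12345 :
    ∀ c : Perm (Fin 6), c ^ 5 = 1 → c ≠ 1 → ∃ g : Perm (Fin 6), g * c12345 * g⁻¹ = c := by
  unfold c12345
  decide +kernel

/-- KERNEL CHECK: an element of order `5` of `S₆` has exactly one fixed letter. [folklore] -/
theorem unique_fixed_of_orderFive :
    ∀ c : Perm (Fin 6), c ^ 5 = 1 → c ≠ 1 → ∃ f : Fin 6, c f = f ∧ ∀ x, c x = x → x = f := by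
  decide +kernel

/-- KERNEL CHECK: an element of order `5` of `S₆` acts transitively (by its powers) on the letters it
moves. [folklore] -/
theorem transitive_of_orderFive :
    ∀ c : Perm (Fin 6), c ^ 5 = 1 → c ≠ 1 →
      ∀ x y : Fin 6, c x ≠ x → c y ≠ y → ∃ i : Fin 5, (c ^ (i : ℕ)) x = y := by
  decide +kernel

/-! ### B. `Stab(6)` is maximal in `S₆` -/

/-- **Maximality of `S₅(b)`**: a subgroup of `S₆` containing `Stab(6)` and an element moving `6` is
`S₆`.  (For `g(6) ≠ 6` the `6`-cycle `(1 2 3 4 5 6)` is `s₁ g s₂` with `s₁, s₂ ∈ Stab(6)`; a `6`-cycle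
and `(1 2)` generate `S₆`, Mathlib `closure_cycle_adjacent_swap`.) [folklore] -/
theorem eq_top_of_stabilizer_le {G : Subgroup (Perm (Fin 6))}
    (hle : MulAction.stabilizer (Perm (Fin 6)) (5 : Fin 6) ≤ G) {g : Perm (Fin 6)} (hg : g ∈ G)
    (hg5 : g 5 ≠ 5) : G = ⊤ := by
  have hstab : ∀ s : Perm (Fin 6), s 5 = 5 → s ∈ G := fun s hs =>
    hle (by rw [MulAction.mem_stabilizer_iff, Perm.smul_def]; exact hs)
  set y : Fin 6 := g⁻¹ 5 with hy
  have hy5 : y ≠ 5 := by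
    intro h
    apply hg5
    have h' : g (g⁻¹ 5) = g 5 := by rw [← hy, h]
    simpa using h'.symm
  let s₂ : Perm (Fin 6) := if y = 4 then 1 else swap 4 y
  have hs₂4 : s₂ 4 = y := by
    by_cases h : y = 4
    · simp [s₂, h]
    · simp [s₂, h, swap_apply_left]
  have hs₂5 : s₂ 5 = 5 := by
    by_cases h : y = 4
    · simp [s₂, h]
    · simp only [s₂, h, if_false]
      exact swap_apply_of_ne_of_ne (by decide) (Ne.symm hy5)
  let s₁ : Perm (Fin 6) := finRotate 6 * s₂⁻¹ * g⁻¹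
  have hs₁5 : s₁ 5 = 5 := by
    have h4 : s₂⁻¹ y = 4 := by rw [Perm.inv_eq_iff_eq]; exact hs₂4.symm
    show finRotate 6 (s₂⁻¹ (g⁻¹ 5)) = 5
    rw [← hy, h4]
    decide
  have hrot : finRotate 6 ∈ G := by
    have : finRotate 6 = s₁ * g * s₂ := by simp [s₁, mul_assoc]
    rw [this]
    exact G.mul_mem (G.mul_mem (hstab _ hs₁5) hg) (hstab _ hs₂5)
  have hsw : swap (0 : Fin 6) (finRotate 6 0) ∈ G := hstab _ (by decide)
  have htop := closure_cycle_adjacent_swap (isCycle_finRotate (n := 4)) (support_finRotate (n := 4))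
    (0 : Fin 6)
  rw [eq_top_iff, ← htop, Subgroup.closure_le]
  rintro x hx
  rcases hx with rfl | rfl
  · exact hrot
  · exact hsw

/-! ### C. (GT2) Transposition + element of order `5` -/

/-- **(GT2), explicit form.** A subgroup `G ≤ S₆` containing a transposition `(a b)` and an element `c`
of order `5` is a point stabilizer `Stab(x)` (`≅ S₅`, the printed `S₅(b)` class: it contains
transpositions = transvections) or `S₆`. [cite: BrumerEtAl2019, Example 5.1.9 p. 1174] -/
theorem eq_stabilizer_or_top_of_swap_mem_of_orderFive_mem (G : Subgroup (Perm (Fin 6)))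
    {a b : Fin 6} (hab : a ≠ b) (hτ : swap a b ∈ G) {c : Perm (Fin 6)} (hc5 : c ^ 5 = 1)
    (hc1 : c ≠ 1) (hc : c ∈ G) :
    (∃ x : Fin 6, G = MulAction.stabilizer (Perm (Fin 6)) x) ∨ G = ⊤ := by
  obtain ⟨g, hg⟩ := exists_conj_c12345 c hc5 hc1
  set G' : Subgroup (Perm (Fin 6)) := G.comap (MulAut.conj g).toMonoidHom with hG'def
  have hmem : ∀ x : Perm (Fin 6), x ∈ G' ↔ g * x * g⁻¹ ∈ G := fun x => by
    rw [hG'def, Subgroup.mem_comap, MulEquiv.coe_toMonoidHom, MulAut.conj_apply]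
  have hc' : c12345 ∈ G' := by rw [hmem, hg]; exact hc
  have hτ' : swap (g⁻¹ a) (g⁻¹ b) ∈ G' := by
    rw [hmem, ← Equiv.swap_apply_apply]
    simpa using hτ
  have hab' : g⁻¹ a ≠ g⁻¹ b := fun h => hab (g⁻¹.injective h)
  have ht12 : t12 ∈ G' := by
    refine (Subgroup.closure_le G').mpr ?_ (t12_mem_closure_swap hab')
    rintro _ ⟨i, rfl⟩
    fin_cases i
    · exact hτ'
    · exact hc'
  have hle : MulAction.stabilizer (Perm (Fin 6)) (5 : Fin 6) ≤ G' := by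
    rw [stabilizer_eq_closure, Subgroup.closure_le]
    rintro _ ⟨i, rfl⟩
    fin_cases i
    · exact hc'
    · exact ht12
  have hGback : G = G'.map (MulAut.conj g).toMonoidHom := by
    rw [hG'def, Subgroup.map_comap_eq_self_of_surjective]
    exact (MulAut.conj g).surjective
  by_cases hall : ∀ x ∈ G', x 5 = 5
  · left
    have hG'eq : G' = MulAction.stabilizer (Perm (Fin 6)) (5 : Fin 6) :=
      le_antisymm (fun x hx => by
        rw [MulAction.mem_stabilizer_iff, Perm.smul_def]; exact hall x hx) hle
    refine ⟨g 5, ?_⟩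
    rw [hGback, hG'eq, ← MulAction.stabilizer_smul_eq_stabilizer_map_conj, Perm.smul_def]
  · right
    push Not at hall
    obtain ⟨x, hx, hx5⟩ := hall
    have hG'top : G' = ⊤ := eq_top_of_stabilizer_le hle hx hx5
    rw [hGback, hG'top, ← MonoidHom.range_eq_map, MonoidHom.range_eq_top]
    exact (MulAut.conj g).surjective

/-- Cauchy: `5 ∣ #G` gives an element of order `5` in `G ≤ S₆`. [folklore] -/
theorem exists_orderFive_of_five_dvd_card (G : Subgroup (Perm (Fin 6))) (h5 : 5 ∣ Nat.card G) :
    ∃ c ∈ G, c ^ 5 = 1 ∧ c ≠ 1 := by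
  haveI : Fact (Nat.Prime 5) := ⟨by decide⟩
  obtain ⟨x, hx⟩ := exists_prime_orderOf_dvd_card' (G := G) 5 h5
  refine ⟨x.1, x.2, ?_, ?_⟩
  · have h := congrArg Subtype.val (pow_orderOf_eq_one x)
    rw [hx, Subgroup.coe_pow, Subgroup.coe_one] at h
    exact h
  · intro h1
    have hx1 : x = 1 := Subtype.ext h1
    rw [hx1, orderOf_one] at hx
    exact absurd hx (by norm_num)

/-- **(GT2) — "a subgroup of `S₆ ≅ Sp₄(𝔽₂)` containing a transposition (= transvection) and of order
divisible by `5` is `S₅(b)` (a point stabilizer) or `S₆`"** — the Jordan-type ingredient of the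
residual step (cell certificates, Route T), as a kernel theorem. [cite: BrumerEtAl2019, Example 5.1.9 p. 1174] -/
theorem eq_stabilizer_or_top_of_isSwap_mem_of_five_dvd_card (G : Subgroup (Perm (Fin 6)))
    {τ : Perm (Fin 6)} (hτ : τ.IsSwap) (hτG : τ ∈ G) (h5 : 5 ∣ Nat.card G) :
    (∃ x : Fin 6, G = MulAction.stabilizer (Perm (Fin 6)) x) ∨ G = ⊤ := by
  obtain ⟨a, b, hab, rfl⟩ := hτ
  obtain ⟨c, hc, hc5, hc1⟩ := exists_orderFive_of_five_dvd_card G h5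
  exact eq_stabilizer_or_top_of_swap_mem_of_orderFive_mem G hab hτG hc5 hc1 hc

/-! ### D. (GT1) Faithful transitive action of degree `5` or `6` -/

/-- **(GT1), explicit form.** If `G ≤ S₆` contains an element `c` of order `5`, there is a set `O` of
`5` or `6` letters which is `G`-stable, on which `G` acts transitively and faithfully (so `Stab_G(x)`,
`x ∈ O`, is a core-free subgroup of index `5` or `6`): `O` = the five letters moved by `c` if `G`
fixes the sixth, else all six letters. [folklore] -/
theorem exists_faithful_transitive_block (G : Subgroup (Perm (Fin 6))) {c : Perm (Fin 6)}
    (hc5 : c ^ 5 = 1) (hc1 : c ≠ 1) (hc : c ∈ G) :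
    ∃ O : Finset (Fin 6), (O.card = 5 ∨ O.card = 6) ∧ (∀ g ∈ G, ∀ x ∈ O, g x ∈ O) ∧
      (∀ x ∈ O, ∀ y ∈ O, ∃ g ∈ G, g x = y) ∧ ∀ g ∈ G, (∀ x ∈ O, g x = x) → g = 1 := by
  obtain ⟨f, -, hfuniq⟩ := unique_fixed_of_orderFive c hc5 hc1
  have htrans := transitive_of_orderFive c hc5 hc1
  by_cases hfix : ∀ g ∈ G, g f = f
  · refine ⟨Finset.univ.erase f, Or.inl (by simp [Finset.card_erase_of_mem]), ?_, ?_, ?_⟩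
    · intro g hg x hx
      rw [Finset.mem_erase] at hx ⊢
      exact ⟨fun h => hx.1 (g.injective (h.trans (hfix g hg).symm)), Finset.mem_univ _⟩
    · intro x hx y hy
      rw [Finset.mem_erase] at hx hy
      obtain ⟨i, hi⟩ := htrans x y (fun h => hx.1 (hfuniq x h)) (fun h => hy.1 (hfuniq y h))
      exact ⟨c ^ (i : ℕ), G.pow_mem hc _, hi⟩
    · intro g hg hgO
      refine Equiv.ext fun x => ?_
      rw [Perm.one_apply]
      by_cases hx : x = f
      · rw [hx]; exact hfix g hg
      · exact hgO x (Finset.mem_erase.mpr ⟨hx, Finset.mem_univ _⟩)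
  · push Not at hfix
    obtain ⟨g₀, hg₀, hg₀f⟩ := hfix
    have reach : ∀ x : Fin 6, ∃ g ∈ G, g f = x := by
      intro x
      by_cases hx : x = f
      · exact ⟨1, G.one_mem, by rw [hx, Perm.one_apply]⟩
      · obtain ⟨i, hi⟩ := htrans (g₀ f) x (fun h => hg₀f (hfuniq _ h)) (fun h => hx (hfuniq x h))
        exact ⟨c ^ (i : ℕ) * g₀, G.mul_mem (G.pow_mem hc _) hg₀, by rw [Perm.mul_apply]; exact hi⟩
    refine ⟨Finset.univ, Or.inr (by simp), fun _ _ _ _ => Finset.mem_univ _, ?_, ?_⟩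
    · intro x _ y _
      obtain ⟨gx, hgx, hx⟩ := reach x
      obtain ⟨gy, hgy, hy⟩ := reach y
      refine ⟨gy * gx⁻¹, G.mul_mem hgy (G.inv_mem hgx), ?_⟩
      have hinv : gx⁻¹ x = f := by rw [Perm.inv_eq_iff_eq]; exact hx.symm
      rw [Perm.mul_apply, hinv, hy]
    · intro g _ hg
      refine Equiv.ext fun x => ?_
      rw [Perm.one_apply]
      exact hg x (Finset.mem_univ _)

/-- **(GT1) — "a subgroup of `S₆` of order divisible by `5` has a core-free subgroup of index `5` or
`6`"** (faithful transitive action on `5` or `6` letters), the ingredient producing the quintic or sextic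
field in the residual step (cell certificates, Route T), as a kernel theorem. [folklore] -/
theorem exists_faithful_transitive_block_of_five_dvd_card (G : Subgroup (Perm (Fin 6)))
    (h5 : 5 ∣ Nat.card G) :
    ∃ O : Finset (Fin 6), (O.card = 5 ∨ O.card = 6) ∧ (∀ g ∈ G, ∀ x ∈ O, g x ∈ O) ∧
      (∀ x ∈ O, ∀ y ∈ O, ∃ g ∈ G, g x = y) ∧ ∀ g ∈ G, (∀ x ∈ O, g x = x) → g = 1 := by
  obtain ⟨c, hc, hc5, hc1⟩ := exists_orderFive_of_five_dvd_card G h5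
  exact exists_faithful_transitive_block G hc5 hc1 hc

/-! ### E. Transvections of `Sp₄(𝔽₂)` = transpositions of `S₆` under `ι` -/

/-- Fast entry formula for `ι`: `ι(σ)_{i,j} = Q_{i,σ(lo j)} + Q_{i,σ(hi j)}` (column `j` of `ι(σ)` is `Q`
of the pair vector `σ(eⱼ)`, `eⱼ = u_{lo j} + u_{hi j}`). [cite: BrumerEtAl2019, (5.1.1) p. 1173] -/
def iotaE (σ : Perm (Fin 6)) : Matrix (Fin 4) (Fin 4) (ZMod 2) :=
  Matrix.of fun i j => projZ i (σ (loIdx j)) + projZ i (σ (hiIdx j))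

/-- `Q (u_a + u_b) = Q u_a + Q u_b` entrywise (kernel check, `a ≠ b`). [folklore] -/
theorem projZ_mulVec_pair : ∀ (i : Fin 4) (a b : Fin 6), a ≠ b →
    Matrix.mulVec projZ (pair a b) i = projZ i a + projZ i b := by
  unfold projZ pair; decide

/-- `ι = iotaE`. [cite: BrumerEtAl2019, (5.1.1) p. 1173] -/
theorem iota_eq_iotaE (σ : Perm (Fin 6)) : iota σ = iotaE σ := by
  ext i j
  rw [iota_apply_eq_mulVec, iotaE, Matrix.of_apply]
  exact projZ_mulVec_pair i _ _ (fun h => loIdx_ne_hiIdx j (σ.injective h))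

/-- A **transvection** of `GL₄(𝔽₂)`: `g ≠ 1`, `(g - 1)² = 0` and `g - 1` of rank one (all `2 × 2`
minors vanish; over `𝔽₂`, `g - 1 = g + 1`).  For `g ∈ Sp₄(𝔽₂)` these are the symplectic transvections
`x ↦ x + ⟨x,u⟩u`, `u ≠ 0` ("`2 × 2` Jordan block" of [BPPTVY, proof of Prop. 5.2.4 p. 1175]). [folklore] -/
def IsTransvection (g : Matrix (Fin 4) (Fin 4) (ZMod 2)) : Prop :=
  g ≠ 1 ∧ (g + 1) * (g + 1) = 0 ∧
    ∀ i j k l : Fin 4, i < j → k < l → (g + 1) i k * (g + 1) j l = (g + 1) i l * (g + 1) j k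

/-- `IsTransvection` is decidable (a finite conjunction over `𝔽₂`). [folklore] -/
instance (g : Matrix (Fin 4) (Fin 4) (ZMod 2)) : Decidable (IsTransvection g) := by
  unfold IsTransvection; infer_instance

set_option maxRecDepth 200000 in
/-- KERNEL CHECK over the `720` elements of `S₆` (via the fast formula `iotaE`): `ι(σ)` is a
transvection iff `σ` is a transposition. [cite: BrumerEtAl2019, Example 5.1.9 p. 1174] -/
theorem isTransvection_iotaE_iff :
    ∀ σ : Perm (Fin 6), IsTransvection (iotaE σ) ↔ ∃ a b : Fin 6, a ≠ b ∧ σ = swap a b := by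
  unfold IsTransvection iotaE projZ loIdx hiIdx
  decide +kernel

/-- **`ι(σ)` is a transvection iff `σ` is a transposition** — so, under the printed `ι` of (5.1.1),
"transvection" and "transposition" are interchangeable ([BPPTVY, Example 5.1.9 p. 1174]: "`ι(S₅(b))`
has transvections while `ι(S₅(a))` does not"; proof of Prop. 5.2.4 p. 1175: inertia at `p ∥ N` acts
through a `2 × 2` Jordan block). [cite: BrumerEtAl2019, Example 5.1.9 p. 1174] -/
theorem isTransvection_iota_iff_exists_swap (σ : Perm (Fin 6)) :
    IsTransvection (iota σ) ↔ ∃ a b : Fin 6, a ≠ b ∧ σ = swap a b := by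
  rw [iota_eq_iotaE]; exact isTransvection_iotaE_iff σ

/-- `ι(σ)` is a transvection iff `σ` is a transposition (`Equiv.Perm.IsSwap`). [cite: BrumerEtAl2019, Example 5.1.9 p. 1174] -/
theorem isTransvection_iota_iff (σ : Perm (Fin 6)) : IsTransvection (iota σ) ↔ σ.IsSwap :=
  isTransvection_iota_iff_exists_swap σ

/-- **(GT2) in `GSp₄(𝔽₂)`-language**: a subgroup of `S₆ ≅ Sp₄(𝔽₂)` containing an element whose
`ι`-image is a transvection and of order divisible by `5` is `S₅(b) = Stab(x)` or `S₆` — the form used by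
the residual step (transvection from inertia at `N`, order `5` from a Frobenius with `Q_p ≡ Φ₅ mod 2`). [cite: BrumerEtAl2019, Example 5.1.9 p. 1174] -/
theorem eq_stabilizer_or_top_of_transvection_mem_of_five_dvd_card (G : Subgroup (Perm (Fin 6)))
    {t : Perm (Fin 6)} (ht : IsTransvection (iota t)) (htG : t ∈ G) (h5 : 5 ∣ Nat.card G) :
    (∃ x : Fin 6, G = MulAction.stabilizer (Perm (Fin 6)) x) ∨ G = ⊤ :=
  eq_stabilizer_or_top_of_isSwap_mem_of_five_dvd_card G ((isTransvection_iota_iff t).1 ht) htG h5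

/-! ### F. Corollaries: `S₅(a)` has no transvections; `orderOf` form -/

/-- **A transitive proper subgroup of `S₆` of order divisible by `5` contains no transposition** —
equivalently (`isTransvection_iota_iff`) its `ι`-image contains no transvection.  This is the content
of "`ι(S₅(a))` does not have transvections" for the transitive `S₅(a) ≅ PGL₂(𝔽₅) ≤ S₆`
([BPPTVY, Example 5.1.9 p. 1174]) used in the proof of [BPPTVY, Lemma 5.2.1 p. 1174] ("if `A` is
semistable and the Galois group is `S₅(a)`, then the toroidal dimension at the bad primes is `2` since
there are no transvections"): by (GT2) a transposition would force `G = Stab(x)` (not transitive) or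
`G = S₆`. [cite: BrumerEtAl2019, Example 5.1.9 + Lemma 5.2.1 p. 1174] -/
theorem not_isSwap_of_mem_transitive (G : Subgroup (Perm (Fin 6))) (h5 : 5 ∣ Nat.card G)
    (htrans : ∀ x y : Fin 6, ∃ g ∈ G, g x = y) (hne : G ≠ ⊤) {τ : Perm (Fin 6)} (hτG : τ ∈ G) :
    ¬ τ.IsSwap := by
  intro hτ
  rcases eq_stabilizer_or_top_of_isSwap_mem_of_five_dvd_card G hτ hτG h5 with ⟨x, hx⟩ | htop
  · obtain ⟨y, hy⟩ := exists_ne x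
    obtain ⟨g, hg, hgx⟩ := htrans x y
    rw [hx, MulAction.mem_stabilizer_iff, Perm.smul_def] at hg
    exact hy (hgx.symm.trans hg)
  · exact hne htop

/-- The same in `GSp₄(𝔽₂)`-language: a transitive proper subgroup of `S₆` of order divisible by `5`
has no element whose `ι`-image is a transvection. [cite: BrumerEtAl2019, Example 5.1.9 + Lemma 5.2.1 p. 1174] -/
theorem not_isTransvection_of_mem_transitive (G : Subgroup (Perm (Fin 6))) (h5 : 5 ∣ Nat.card G)
    (htrans : ∀ x y : Fin 6, ∃ g ∈ G, g x = y) (hne : G ≠ ⊤) {t : Perm (Fin 6)} (htG : t ∈ G) :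
    ¬ IsTransvection (iota t) := fun ht =>
  not_isSwap_of_mem_transitive G h5 htrans hne htG ((isTransvection_iota_iff t).1 ht)

/-- `orderOf c = 5` ⇒ `c⁵ = 1 ∧ c ≠ 1` (the hypothesis shape of the kernel lemmas above). [folklore] -/
theorem pow_five_eq_one_and_ne_one_of_orderOf_eq {c : Perm (Fin 6)} (h : orderOf c = 5) :
    c ^ 5 = 1 ∧ c ≠ 1 :=
  ⟨by rw [← h]; exact pow_orderOf_eq_one c,
    fun h1 => by rw [h1, orderOf_one] at h; exact absurd h (by decide)⟩

/-- (GT2) with an `orderOf` hypothesis. [cite: BrumerEtAl2019, Example 5.1.9 p. 1174] -/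
theorem eq_stabilizer_or_top_of_swap_mem_of_orderOf_eq (G : Subgroup (Perm (Fin 6)))
    {a b : Fin 6} (hab : a ≠ b) (hτ : swap a b ∈ G) {c : Perm (Fin 6)} (hc : orderOf c = 5)
    (hcG : c ∈ G) : (∃ x : Fin 6, G = MulAction.stabilizer (Perm (Fin 6)) x) ∨ G = ⊤ :=
  eq_stabilizer_or_top_of_swap_mem_of_orderFive_mem G hab hτ
    (pow_five_eq_one_and_ne_one_of_orderOf_eq hc).1 (pow_five_eq_one_and_ne_one_of_orderOf_eq hc).2 hcG

end Literature.NumberTheory.FaltingsSerre.GSp4F2
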